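import Literature.InformationTheory.QuantumCodes.DistanceFailureFloorPhenomenological
import Summits.Ventures.QEC.Theorems.BB72DistanceCertificateTarget
import Summits.Ventures.QEC.Theorems.BB90DistanceCertificateTarget
import Summits.Ventures.QEC.Theorems.BB108DistanceCertificateTarget
import Summits.Ventures.QEC.Theorems.BB144DistanceCertificateTarget
import Summits.Ventures.QEC.Theorems.BB288DistanceCertificateCoverLowerZ
import HarnessLib

/-!
# Certified FLOORS on the logical error rate of the five Bravyi-et-al. bivariate-bicycle codes, EVERY decoder:
# `[[72,12,6]]`, `[[90,8,10]]`, `[[108,8,10]]`, `[[144,12,12]]`, `[[288,12,18]]`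

Venture QEC, `Summits/Ventures/QEC/Thresholds/` (LADDER-QEC rungs Q2/Q4/Q5: the census meets the noise statements;
qec-lit-2 gen 6). HONEST FRAMING. `Literature/…/DistanceFailureFloor.lean` proves, for every CSS code with `k ≥ 1`,
EVERY decoder (maximum-likelihood included) and independent flips of rate `0 ≤ p ≤ 1/2`, the per-sector floor
`½·C(d,⌈d/2⌉)·p^{⌈d/2⌉}(1−p)^{⌊d/2⌋} ≤ P_fail` (Dennis et al. §3: "`L/2` errors could suffice to cause damage", made
quantitative by pairing `e ↔ e + L`), and `y^d ≤ P_y[erasure uncorrectable]`. This file feeds it the KERNEL-certified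
distances of the five codes of [BravyiEtAl2024] Table 1 (`BB72_12_6_claim_holds`, `BB90_8_10_claim_holds`,
`BB108_8_10_claim_holds`, `BB144_12_12_claim_holds`, `BB288_12_18_claim_holds_std`; all axioms standard): every
row below is an UNCONDITIONAL kernel theorem about the named code and holds for EVERY decoder of the sector — at
code capacity AND, with the same floor, for every space-time decoder under `T ≥ 1` rounds of noisy syndrome
measurement at ANY measurement-error rate `q ∈ [0,1]` (`DistanceFailureFloorPhenomenological.lean`: the record sees
one round's qubit faults only through their syndrome) —

| code | `Z`- and `X`-sector floor, code capacity and phenomenological (`0 ≤ p ≤ 1/2`) | erasures (`0 ≤ y ≤ 1`) |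
|---|---|---|
| `[[72,12,6]]`   | `10 · p³(1−p)³ ≤ P_fail`        | `y⁶ ≤ P[unc.]`  |
| `[[90,8,10]]`   | `126 · p⁵(1−p)⁵ ≤ P_fail`       | `y¹⁰ ≤ P[unc.]` |
| `[[108,8,10]]`  | `126 · p⁵(1−p)⁵ ≤ P_fail`       | `y¹⁰ ≤ P[unc.]` |
| `[[144,12,12]]` | `462 · p⁶(1−p)⁶ ≤ P_fail`       | `y¹² ≤ P[unc.]` |
| `[[288,12,18]]` | `24310 · p⁹(1−p)⁹ ≤ P_fail`     | `y¹⁸ ≤ P[unc.]` |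

(gross code at `p = 10⁻³`: `P_fail ≥ 4.59·10⁻¹⁶` per sector, any decoder). FLOOR counterparts of the DKP15 CEILINGS of
`BBFiniteSizeBounds.lean` / `BB144FiniteSizeBounds.lean`; floor and ceiling never merged; no Monte Carlo value. Generic
census forms `BB.distanceFloor_le_*_of_hasParams` for any discharged `HasParams C n k d`, `k ≥ 1`. Kernel axioms only.

## References

* [DennisEtAl2002] Dennis–Kitaev–Landahl–Preskill, J. Math. Phys. 43 (2002) 4452, §3 ("L/2 errors"), §4.2–4.3, §5.2.
* [BravyiEtAl2024] S. Bravyi et al., Nature 627 (2024) 778, Table 1 (the five codes).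
-/

noncomputable section

namespace Summit.Ventures.QEC.Thresholds

open Finset Matrix
open Literature.InformationTheory.QuantumCodes
open Summit.Ventures.QEC.BB

/-! ### Generic census form: any `QC(A,B)` row with discharged parameters -/

section Generic

variable {ℓ m : ℕ} [NeZero ℓ] [NeZero m]

open Classical in
/-- **Census form, `Z`-sector**: a bivariate-bicycle code with discharged parameters `[[n,k,d]]`, `k ≥ 1`, has
`½·C(d,⌈d/2⌉)·p^{⌈d/2⌉}(1−p)^{⌊d/2⌋} ≤ P^Z_p[D fails]` for EVERY decoder of the `X`-syndrome (`0 ≤ p ≤ 1/2`).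
[cite: DennisEtAl2002, §3 and §4.3; BravyiEtAl2024, Lemma 1 (d = d^X = d^Z)] -/
theorem BB.distanceFloor_le_zFailure_of_hasParams (C : BB.Code ℓ m) {n k d : ℕ} (h : HasParams C n k d)
    (hk : 0 < k) (D : Decoder (BB.Mono ℓ m → ZMod 2) (BB.Mono ℓ m ⊕ BB.Mono ℓ m → ZMod 2)) {p : ℝ} (hp0 : 0 ≤ p)
    (hp : p ≤ 1 / 2) :
    1 / 2 * ((d.choose ((d + 1) / 2) : ℝ) * (p ^ ((d + 1) / 2) * (1 - p) ^ (d / 2))) ≤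
      ∑ e ∈ univ.filter (fun e : BB.Mono ℓ m ⊕ BB.Mono ℓ m → ZMod 2 =>
        ¬ D.Corrects C.css.zSyndrome (C.css.rowSpZ : Set (BB.Mono ℓ m ⊕ BB.Mono ℓ m → ZMod 2)) e),
        bernoulliWeight p (supp e) := by
  have hkC : 0 < C.css.k := by
    have : C.css.k = k := h.2.1
    omega
  have hf := C.css.distanceFloor_le_zFailure hkC D hp0 hp
  rw [(dX_eq_of_hasParams h).2] at hf
  exact hf

open Classical in
/-- **Census form, `X`-sector** (decoders of the `Z`-syndrome, bit flips).
[cite: DennisEtAl2002, §3 and §4.3; BravyiEtAl2024, Lemma 1 (d = d^X = d^Z)] -/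
theorem BB.distanceFloor_le_xFailure_of_hasParams (C : BB.Code ℓ m) {n k d : ℕ} (h : HasParams C n k d)
    (hk : 0 < k) (D : Decoder (BB.Mono ℓ m → ZMod 2) (BB.Mono ℓ m ⊕ BB.Mono ℓ m → ZMod 2)) {p : ℝ} (hp0 : 0 ≤ p)
    (hp : p ≤ 1 / 2) :
    1 / 2 * ((d.choose ((d + 1) / 2) : ℝ) * (p ^ ((d + 1) / 2) * (1 - p) ^ (d / 2))) ≤
      ∑ e ∈ univ.filter (fun e : BB.Mono ℓ m ⊕ BB.Mono ℓ m → ZMod 2 =>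
        ¬ D.Corrects C.css.xSyndrome (C.css.rowSpX : Set (BB.Mono ℓ m ⊕ BB.Mono ℓ m → ZMod 2)) e),
        bernoulliWeight p (supp e) := by
  have hkC : 0 < C.css.k := by
    have : C.css.k = k := h.2.1
    omega
  have hf := C.css.distanceFloor_le_xFailure hkC D hp0 hp
  rw [(dX_eq_of_hasParams h).1] at hf
  exact hf

/-- **Census form, optimal decoding**: the floor for `zOptimalFailure` and `xOptimalFailure`.
[cite: DennisEtAl2002, §4.3 (the optimal way to recover); BravyiEtAl2024, Lemma 1] -/
theorem BB.distanceFloor_le_optimalFailure_of_hasParams (C : BB.Code ℓ m) {n k d : ℕ} (h : HasParams C n k d)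
    (hk : 0 < k) {p : ℝ} (hp0 : 0 ≤ p) (hp : p ≤ 1 / 2) :
    1 / 2 * ((d.choose ((d + 1) / 2) : ℝ) * (p ^ ((d + 1) / 2) * (1 - p) ^ (d / 2))) ≤ C.css.zOptimalFailure p ∧
      1 / 2 * ((d.choose ((d + 1) / 2) : ℝ) * (p ^ ((d + 1) / 2) * (1 - p) ^ (d / 2))) ≤ C.css.xOptimalFailure p := by
  have hkC : 0 < C.css.k := by
    have : C.css.k = k := h.2.1
    omega
  have hZ := C.css.distanceFloor_le_zOptimalFailure hkC hp0 hp
  have hX := C.css.distanceFloor_le_xOptimalFailure hkC hp0 hp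
  rw [(dX_eq_of_hasParams h).2] at hZ
  rw [(dX_eq_of_hasParams h).1] at hX
  exact ⟨hZ, hX⟩

/-- **Census form, erasures**: `y^d ≤ P^Z_y[uncorrectable]` and `y^d ≤ P^X_y[uncorrectable]` (`0 ≤ y ≤ 1`).
[cite: DelfosseZemor2020, §2 (failure iff a logical operator L ⊂ ℰ); BravyiEtAl2024, Lemma 1] -/
theorem BB.pow_le_uncorrectableProb_of_hasParams (C : BB.Code ℓ m) {n k d : ℕ} (h : HasParams C n k d)
    (hk : 0 < k) {y : ℝ} (hy0 : 0 ≤ y) (hy1 : y ≤ 1) :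
    y ^ d ≤ ErasureDecoder.uncorrectableProb {x : BB.Mono ℓ m ⊕ BB.Mono ℓ m → ZMod 2 | C.css.HX *ᵥ x = 0}
        (C.css.rowSpZ : Set (BB.Mono ℓ m ⊕ BB.Mono ℓ m → ZMod 2)) y ∧
      y ^ d ≤ ErasureDecoder.uncorrectableProb {x : BB.Mono ℓ m ⊕ BB.Mono ℓ m → ZMod 2 | C.css.HZ *ᵥ x = 0}
        (C.css.rowSpX : Set (BB.Mono ℓ m ⊕ BB.Mono ℓ m → ZMod 2)) y := by
  have hkC : 0 < C.css.k := by
    have : C.css.k = k := h.2.1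
    omega
  have hZ := C.css.pow_dZ_le_zUncorrectableProb hkC hy0 hy1
  have hX := C.css.pow_dX_le_xUncorrectableProb hkC hy0 hy1
  rw [(dX_eq_of_hasParams h).2] at hZ
  rw [(dX_eq_of_hasParams h).1] at hX
  exact ⟨hZ, hX⟩

/-- **Census form, noisy syndrome measurement** (`T ≥ 1` rounds, `t₀ : Fin T`, qubit rate `0 ≤ p ≤ 1/2`, measurement
rate `0 ≤ q ≤ 1`, EVERY space-time decoder of each sector): the same floor `½·C(d,⌈d/2⌉)·p^{⌈d/2⌉}(1−p)^{⌊d/2⌋}`.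
[cite: DennisEtAl2002, §3, §4.2–4.3 and §5.2 (Prob_fail); BravyiEtAl2024, Lemma 1] -/
theorem BB.distanceFloor_le_phenomFailureProb_of_hasParams (C : BB.Code ℓ m) {n k d : ℕ} (h : HasParams C n k d)
    (hk : 0 < k) {T : ℕ} (DZ : CSSPhenom.STDecoder (BB.Mono ℓ m) (BB.Mono ℓ m ⊕ BB.Mono ℓ m) T)
    (DX : CSSPhenom.STDecoder (BB.Mono ℓ m) (BB.Mono ℓ m ⊕ BB.Mono ℓ m) T) (t₀ : Fin T) {p q : ℝ} (hp0 : 0 ≤ p)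
    (hp : p ≤ 1 / 2) (hq0 : 0 ≤ q) (hq1 : q ≤ 1) :
    1 / 2 * ((d.choose ((d + 1) / 2) : ℝ) * (p ^ ((d + 1) / 2) * (1 - p) ^ (d / 2))) ≤
        CSSPhenom.phenomFailureProb C.css.HX T (C.css.rowSpZ : Set (BB.Mono ℓ m ⊕ BB.Mono ℓ m → ZMod 2)) DZ p q ∧
      1 / 2 * ((d.choose ((d + 1) / 2) : ℝ) * (p ^ ((d + 1) / 2) * (1 - p) ^ (d / 2))) ≤
        CSSPhenom.phenomFailureProb C.css.HZ T (C.css.rowSpX : Set (BB.Mono ℓ m ⊕ BB.Mono ℓ m → ZMod 2)) DX p q := by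
  have hkC : 0 < C.css.k := by
    have : C.css.k = k := h.2.1
    omega
  have hZ := C.css.distanceFloor_le_zPhenomFailureProb hkC DZ t₀ hp0 hp hq0 hq1
  have hX := C.css.distanceFloor_le_xPhenomFailureProb hkC DX t₀ hp0 hp hq0 hq1
  rw [(dX_eq_of_hasParams h).2] at hZ
  rw [(dX_eq_of_hasParams h).1] at hX
  exact ⟨hZ, hX⟩

end Generic

/-! ### The five codes of Bravyi et al., Table 1 — unconditional (KERNEL distance certificates) -/

open Classical in
/-- **`[[72,12,6]]`, every decoder, both sectors**: `10·p³(1−p)³ ≤ P_fail` (`0 ≤ p ≤ 1/2`). UNCONDITIONAL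
(`BB72_12_6_claim_holds`). [cite: DennisEtAl2002, §3 and §4.3; BravyiEtAl2024, Table 1 row [[72,12,6]]] -/
theorem bb72_distanceFloor (D : Decoder (BB.Mono 6 6 → ZMod 2) (BB.Mono 6 6 ⊕ BB.Mono 6 6 → ZMod 2))
    (D' : Decoder (BB.Mono 6 6 → ZMod 2) (BB.Mono 6 6 ⊕ BB.Mono 6 6 → ZMod 2)) {p : ℝ} (hp0 : 0 ≤ p)
    (hp : p ≤ 1 / 2) :
    10 * (p ^ 3 * (1 - p) ^ 3) ≤
        ∑ e ∈ univ.filter (fun e : BB.Mono 6 6 ⊕ BB.Mono 6 6 → ZMod 2 =>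
          ¬ D.Corrects BB.bb72.css.zSyndrome (BB.bb72.css.rowSpZ : Set (BB.Mono 6 6 ⊕ BB.Mono 6 6 → ZMod 2)) e),
          bernoulliWeight p (supp e) ∧
      10 * (p ^ 3 * (1 - p) ^ 3) ≤
        ∑ e ∈ univ.filter (fun e : BB.Mono 6 6 ⊕ BB.Mono 6 6 → ZMod 2 =>
          ¬ D'.Corrects BB.bb72.css.xSyndrome (BB.bb72.css.rowSpX : Set (BB.Mono 6 6 ⊕ BB.Mono 6 6 → ZMod 2)) e),
          bernoulliWeight p (supp e) := by
  have hZ := BB.distanceFloor_le_zFailure_of_hasParams BB.bb72 Census.BB72.BB72_12_6_claim_holds (by norm_num) D hp0 hp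
  have hX := BB.distanceFloor_le_xFailure_of_hasParams BB.bb72 Census.BB72.BB72_12_6_claim_holds (by norm_num) D' hp0 hp
  have hc : ((Nat.choose 6 ((6 + 1) / 2) : ℕ) : ℝ) = 20 := by exact_mod_cast (by decide : Nat.choose 6 ((6 + 1) / 2) = 20)
  rw [hc] at hZ hX
  norm_num at hZ hX
  exact ⟨by linarith, by linarith⟩

open Classical in
/-- **`[[90,8,10]]`, every decoder, both sectors**: `126·p⁵(1−p)⁵ ≤ P_fail` (`0 ≤ p ≤ 1/2`). UNCONDITIONAL
(`BB90_8_10_claim_holds`). [cite: DennisEtAl2002, §3 and §4.3; BravyiEtAl2024, Table 1 row [[90,8,10]]] -/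
theorem bb90_distanceFloor (D : Decoder (BB.Mono 15 3 → ZMod 2) (BB.Mono 15 3 ⊕ BB.Mono 15 3 → ZMod 2))
    (D' : Decoder (BB.Mono 15 3 → ZMod 2) (BB.Mono 15 3 ⊕ BB.Mono 15 3 → ZMod 2)) {p : ℝ} (hp0 : 0 ≤ p)
    (hp : p ≤ 1 / 2) :
    126 * (p ^ 5 * (1 - p) ^ 5) ≤
        ∑ e ∈ univ.filter (fun e : BB.Mono 15 3 ⊕ BB.Mono 15 3 → ZMod 2 =>
          ¬ D.Corrects BB.bb90.css.zSyndrome (BB.bb90.css.rowSpZ : Set (BB.Mono 15 3 ⊕ BB.Mono 15 3 → ZMod 2)) e),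
          bernoulliWeight p (supp e) ∧
      126 * (p ^ 5 * (1 - p) ^ 5) ≤
        ∑ e ∈ univ.filter (fun e : BB.Mono 15 3 ⊕ BB.Mono 15 3 → ZMod 2 =>
          ¬ D'.Corrects BB.bb90.css.xSyndrome (BB.bb90.css.rowSpX : Set (BB.Mono 15 3 ⊕ BB.Mono 15 3 → ZMod 2)) e),
          bernoulliWeight p (supp e) := by
  have hZ := BB.distanceFloor_le_zFailure_of_hasParams BB.bb90 Census.BB90.BB90_8_10_claim_holds (by norm_num) D hp0 hp
  have hX := BB.distanceFloor_le_xFailure_of_hasParams BB.bb90 Census.BB90.BB90_8_10_claim_holds (by norm_num) D' hp0 hp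
  have hc : ((Nat.choose 10 ((10 + 1) / 2) : ℕ) : ℝ) = 252 := by
    exact_mod_cast (by decide : Nat.choose 10 ((10 + 1) / 2) = 252)
  rw [hc] at hZ hX
  norm_num at hZ hX
  exact ⟨by linarith, by linarith⟩

open Classical in
/-- **`[[108,8,10]]`, every decoder, both sectors**: `126·p⁵(1−p)⁵ ≤ P_fail` (`0 ≤ p ≤ 1/2`). UNCONDITIONAL
(`BB108_8_10_claim_holds`). [cite: DennisEtAl2002, §3 and §4.3; BravyiEtAl2024, Table 1 row [[108,8,10]]] -/
theorem bb108_distanceFloor (D : Decoder (BB.Mono 9 6 → ZMod 2) (BB.Mono 9 6 ⊕ BB.Mono 9 6 → ZMod 2))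
    (D' : Decoder (BB.Mono 9 6 → ZMod 2) (BB.Mono 9 6 ⊕ BB.Mono 9 6 → ZMod 2)) {p : ℝ} (hp0 : 0 ≤ p)
    (hp : p ≤ 1 / 2) :
    126 * (p ^ 5 * (1 - p) ^ 5) ≤
        ∑ e ∈ univ.filter (fun e : BB.Mono 9 6 ⊕ BB.Mono 9 6 → ZMod 2 =>
          ¬ D.Corrects BB.bb108.css.zSyndrome (BB.bb108.css.rowSpZ : Set (BB.Mono 9 6 ⊕ BB.Mono 9 6 → ZMod 2)) e),
          bernoulliWeight p (supp e) ∧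
      126 * (p ^ 5 * (1 - p) ^ 5) ≤
        ∑ e ∈ univ.filter (fun e : BB.Mono 9 6 ⊕ BB.Mono 9 6 → ZMod 2 =>
          ¬ D'.Corrects BB.bb108.css.xSyndrome (BB.bb108.css.rowSpX : Set (BB.Mono 9 6 ⊕ BB.Mono 9 6 → ZMod 2)) e),
          bernoulliWeight p (supp e) := by
  have hZ := BB.distanceFloor_le_zFailure_of_hasParams BB.bb108 Census.BB108.BB108_8_10_claim_holds (by norm_num) D
    hp0 hp
  have hX := BB.distanceFloor_le_xFailure_of_hasParams BB.bb108 Census.BB108.BB108_8_10_claim_holds (by norm_num) D'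
    hp0 hp
  have hc : ((Nat.choose 10 ((10 + 1) / 2) : ℕ) : ℝ) = 252 := by
    exact_mod_cast (by decide : Nat.choose 10 ((10 + 1) / 2) = 252)
  rw [hc] at hZ hX
  norm_num at hZ hX
  exact ⟨by linarith, by linarith⟩

open Classical in
/-- **`[[144,12,12]]` (the gross code), every decoder, both sectors**: `462·p⁶(1−p)⁶ ≤ P_fail` (`0 ≤ p ≤ 1/2`;
e.g. `p = 10⁻³`: `≥ 4.59·10⁻¹⁶`). UNCONDITIONAL (`BB144_12_12_claim_holds`).
[cite: DennisEtAl2002, §3 and §4.3; BravyiEtAl2024, Table 1 row [[144,12,12]]] -/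
theorem bb144_distanceFloor (D : Decoder (BB.Mono 12 6 → ZMod 2) (BB.Mono 12 6 ⊕ BB.Mono 12 6 → ZMod 2))
    (D' : Decoder (BB.Mono 12 6 → ZMod 2) (BB.Mono 12 6 ⊕ BB.Mono 12 6 → ZMod 2)) {p : ℝ} (hp0 : 0 ≤ p)
    (hp : p ≤ 1 / 2) :
    462 * (p ^ 6 * (1 - p) ^ 6) ≤
        ∑ e ∈ univ.filter (fun e : BB.Mono 12 6 ⊕ BB.Mono 12 6 → ZMod 2 =>
          ¬ D.Corrects BB.bb144.css.zSyndrome (BB.bb144.css.rowSpZ : Set (BB.Mono 12 6 ⊕ BB.Mono 12 6 → ZMod 2)) e),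
          bernoulliWeight p (supp e) ∧
      462 * (p ^ 6 * (1 - p) ^ 6) ≤
        ∑ e ∈ univ.filter (fun e : BB.Mono 12 6 ⊕ BB.Mono 12 6 → ZMod 2 =>
          ¬ D'.Corrects BB.bb144.css.xSyndrome (BB.bb144.css.rowSpX : Set (BB.Mono 12 6 ⊕ BB.Mono 12 6 → ZMod 2)) e),
          bernoulliWeight p (supp e) := by
  have hZ := BB.distanceFloor_le_zFailure_of_hasParams BB.bb144 Census.BB144.BB144_12_12_claim_holds (by norm_num) D
    hp0 hp
  have hX := BB.distanceFloor_le_xFailure_of_hasParams BB.bb144 Census.BB144.BB144_12_12_claim_holds (by norm_num) D'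
    hp0 hp
  have hc : ((Nat.choose 12 ((12 + 1) / 2) : ℕ) : ℝ) = 924 := by
    exact_mod_cast (by decide : Nat.choose 12 ((12 + 1) / 2) = 924)
  rw [hc] at hZ hX
  norm_num at hZ hX
  exact ⟨by linarith, by linarith⟩

open Classical in
/-- **`[[288,12,18]]`, every decoder, both sectors**: `24310·p⁹(1−p)⁹ ≤ P_fail` (`0 ≤ p ≤ 1/2`). UNCONDITIONAL
(`BB288_12_18_claim_holds_std`, the covering certificate).
[cite: DennisEtAl2002, §3 and §4.3; BravyiEtAl2024, Table 1 row [[288,12,18]]] -/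
theorem bb288_distanceFloor (D : Decoder (BB.Mono 12 12 → ZMod 2) (BB.Mono 12 12 ⊕ BB.Mono 12 12 → ZMod 2))
    (D' : Decoder (BB.Mono 12 12 → ZMod 2) (BB.Mono 12 12 ⊕ BB.Mono 12 12 → ZMod 2)) {p : ℝ} (hp0 : 0 ≤ p)
    (hp : p ≤ 1 / 2) :
    24310 * (p ^ 9 * (1 - p) ^ 9) ≤
        ∑ e ∈ univ.filter (fun e : BB.Mono 12 12 ⊕ BB.Mono 12 12 → ZMod 2 =>
          ¬ D.Corrects BB.bb288.css.zSyndrome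
            (BB.bb288.css.rowSpZ : Set (BB.Mono 12 12 ⊕ BB.Mono 12 12 → ZMod 2)) e), bernoulliWeight p (supp e) ∧
      24310 * (p ^ 9 * (1 - p) ^ 9) ≤
        ∑ e ∈ univ.filter (fun e : BB.Mono 12 12 ⊕ BB.Mono 12 12 → ZMod 2 =>
          ¬ D'.Corrects BB.bb288.css.xSyndrome
            (BB.bb288.css.rowSpX : Set (BB.Mono 12 12 ⊕ BB.Mono 12 12 → ZMod 2)) e), bernoulliWeight p (supp e) := by
  have hZ := BB.distanceFloor_le_zFailure_of_hasParams BB.bb288 Census.BB288.BB288_12_18_claim_holds_std (by norm_num)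
    D hp0 hp
  have hX := BB.distanceFloor_le_xFailure_of_hasParams BB.bb288 Census.BB288.BB288_12_18_claim_holds_std (by norm_num)
    D' hp0 hp
  have hc : ((Nat.choose 18 ((18 + 1) / 2) : ℕ) : ℝ) = 48620 := by
    exact_mod_cast (by decide : Nat.choose 18 ((18 + 1) / 2) = 48620)
  rw [hc] at hZ hX
  norm_num at hZ hX
  exact ⟨by linarith, by linarith⟩

/-- **Optimal (maximum-likelihood) decoding of the five codes obeys the same floors**: `10·p³(1−p)³`,
`126·p⁵(1−p)⁵`, `126·p⁵(1−p)⁵`, `462·p⁶(1−p)⁶`, `24310·p⁹(1−p)⁹ ≤ zOptimalFailure / xOptimalFailure`.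
[cite: DennisEtAl2002, §4.3 (the optimal way to recover); BravyiEtAl2024, Table 1] -/
theorem bb_optimalFailure_floors {p : ℝ} (hp0 : 0 ≤ p) (hp : p ≤ 1 / 2) :
    (10 * (p ^ 3 * (1 - p) ^ 3) ≤ BB.bb72.css.zOptimalFailure p ∧
        10 * (p ^ 3 * (1 - p) ^ 3) ≤ BB.bb72.css.xOptimalFailure p) ∧
      (126 * (p ^ 5 * (1 - p) ^ 5) ≤ BB.bb90.css.zOptimalFailure p ∧
        126 * (p ^ 5 * (1 - p) ^ 5) ≤ BB.bb90.css.xOptimalFailure p) ∧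
      (126 * (p ^ 5 * (1 - p) ^ 5) ≤ BB.bb108.css.zOptimalFailure p ∧
        126 * (p ^ 5 * (1 - p) ^ 5) ≤ BB.bb108.css.xOptimalFailure p) ∧
      (462 * (p ^ 6 * (1 - p) ^ 6) ≤ BB.bb144.css.zOptimalFailure p ∧
        462 * (p ^ 6 * (1 - p) ^ 6) ≤ BB.bb144.css.xOptimalFailure p) ∧
      (24310 * (p ^ 9 * (1 - p) ^ 9) ≤ BB.bb288.css.zOptimalFailure p ∧
        24310 * (p ^ 9 * (1 - p) ^ 9) ≤ BB.bb288.css.xOptimalFailure p) := by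
  have h72 := BB.distanceFloor_le_optimalFailure_of_hasParams BB.bb72 Census.BB72.BB72_12_6_claim_holds (by norm_num)
    hp0 hp
  have h90 := BB.distanceFloor_le_optimalFailure_of_hasParams BB.bb90 Census.BB90.BB90_8_10_claim_holds (by norm_num)
    hp0 hp
  have h108 := BB.distanceFloor_le_optimalFailure_of_hasParams BB.bb108 Census.BB108.BB108_8_10_claim_holds
    (by norm_num) hp0 hp
  have h144 := BB.distanceFloor_le_optimalFailure_of_hasParams BB.bb144 Census.BB144.BB144_12_12_claim_holds
    (by norm_num) hp0 hp
  have h288 := BB.distanceFloor_le_optimalFailure_of_hasParams BB.bb288 Census.BB288.BB288_12_18_claim_holds_std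
    (by norm_num) hp0 hp
  have hc6 : ((Nat.choose 6 ((6 + 1) / 2) : ℕ) : ℝ) = 20 := by exact_mod_cast (by decide : Nat.choose 6 ((6 + 1) / 2) = 20)
  have hc10 : ((Nat.choose 10 ((10 + 1) / 2) : ℕ) : ℝ) = 252 := by
    exact_mod_cast (by decide : Nat.choose 10 ((10 + 1) / 2) = 252)
  have hc12 : ((Nat.choose 12 ((12 + 1) / 2) : ℕ) : ℝ) = 924 := by
    exact_mod_cast (by decide : Nat.choose 12 ((12 + 1) / 2) = 924)
  have hc18 : ((Nat.choose 18 ((18 + 1) / 2) : ℕ) : ℝ) = 48620 := by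
    exact_mod_cast (by decide : Nat.choose 18 ((18 + 1) / 2) = 48620)
  rw [hc6] at h72
  rw [hc10] at h90 h108
  rw [hc12] at h144
  rw [hc18] at h288
  norm_num at h72 h90 h108 h144 h288
  obtain ⟨a72, b72⟩ := h72
  obtain ⟨a90, b90⟩ := h90
  obtain ⟨a108, b108⟩ := h108
  obtain ⟨a144, b144⟩ := h144
  obtain ⟨a288, b288⟩ := h288
  exact ⟨⟨by linarith, by linarith⟩, ⟨by linarith, by linarith⟩, ⟨by linarith, by linarith⟩,
    ⟨by linarith, by linarith⟩, ⟨by linarith, by linarith⟩⟩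

/-- **Erasure floors of the five codes**: `y⁶`, `y¹⁰`, `y¹⁰`, `y¹²`, `y¹⁸ ≤ P_y[erasure uncorrectable]` in both
sectors (`0 ≤ y ≤ 1`). [cite: DelfosseZemor2020, §2; BravyiEtAl2024, Table 1] -/
theorem bb_erasure_floors {y : ℝ} (hy0 : 0 ≤ y) (hy1 : y ≤ 1) :
    (y ^ 6 ≤ ErasureDecoder.uncorrectableProb {x : BB.Mono 6 6 ⊕ BB.Mono 6 6 → ZMod 2 | BB.bb72.css.HX *ᵥ x = 0}
          (BB.bb72.css.rowSpZ : Set (BB.Mono 6 6 ⊕ BB.Mono 6 6 → ZMod 2)) y ∧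
        y ^ 6 ≤ ErasureDecoder.uncorrectableProb {x : BB.Mono 6 6 ⊕ BB.Mono 6 6 → ZMod 2 | BB.bb72.css.HZ *ᵥ x = 0}
          (BB.bb72.css.rowSpX : Set (BB.Mono 6 6 ⊕ BB.Mono 6 6 → ZMod 2)) y) ∧
      (y ^ 10 ≤ ErasureDecoder.uncorrectableProb {x : BB.Mono 15 3 ⊕ BB.Mono 15 3 → ZMod 2 | BB.bb90.css.HX *ᵥ x = 0}
          (BB.bb90.css.rowSpZ : Set (BB.Mono 15 3 ⊕ BB.Mono 15 3 → ZMod 2)) y ∧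
        y ^ 10 ≤ ErasureDecoder.uncorrectableProb {x : BB.Mono 15 3 ⊕ BB.Mono 15 3 → ZMod 2 | BB.bb90.css.HZ *ᵥ x = 0}
          (BB.bb90.css.rowSpX : Set (BB.Mono 15 3 ⊕ BB.Mono 15 3 → ZMod 2)) y) ∧
      (y ^ 10 ≤ ErasureDecoder.uncorrectableProb {x : BB.Mono 9 6 ⊕ BB.Mono 9 6 → ZMod 2 | BB.bb108.css.HX *ᵥ x = 0}
          (BB.bb108.css.rowSpZ : Set (BB.Mono 9 6 ⊕ BB.Mono 9 6 → ZMod 2)) y ∧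
        y ^ 10 ≤ ErasureDecoder.uncorrectableProb {x : BB.Mono 9 6 ⊕ BB.Mono 9 6 → ZMod 2 | BB.bb108.css.HZ *ᵥ x = 0}
          (BB.bb108.css.rowSpX : Set (BB.Mono 9 6 ⊕ BB.Mono 9 6 → ZMod 2)) y) ∧
      (y ^ 12 ≤ ErasureDecoder.uncorrectableProb {x : BB.Mono 12 6 ⊕ BB.Mono 12 6 → ZMod 2 | BB.bb144.css.HX *ᵥ x = 0}
          (BB.bb144.css.rowSpZ : Set (BB.Mono 12 6 ⊕ BB.Mono 12 6 → ZMod 2)) y ∧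
        y ^ 12 ≤ ErasureDecoder.uncorrectableProb {x : BB.Mono 12 6 ⊕ BB.Mono 12 6 → ZMod 2 | BB.bb144.css.HZ *ᵥ x = 0}
          (BB.bb144.css.rowSpX : Set (BB.Mono 12 6 ⊕ BB.Mono 12 6 → ZMod 2)) y) ∧
      (y ^ 18 ≤ ErasureDecoder.uncorrectableProb {x : BB.Mono 12 12 ⊕ BB.Mono 12 12 → ZMod 2 | BB.bb288.css.HX *ᵥ x = 0}
          (BB.bb288.css.rowSpZ : Set (BB.Mono 12 12 ⊕ BB.Mono 12 12 → ZMod 2)) y ∧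
        y ^ 18 ≤ ErasureDecoder.uncorrectableProb {x : BB.Mono 12 12 ⊕ BB.Mono 12 12 → ZMod 2 | BB.bb288.css.HZ *ᵥ x = 0}
          (BB.bb288.css.rowSpX : Set (BB.Mono 12 12 ⊕ BB.Mono 12 12 → ZMod 2)) y) :=
  ⟨BB.pow_le_uncorrectableProb_of_hasParams BB.bb72 Census.BB72.BB72_12_6_claim_holds (by norm_num) hy0 hy1,
    BB.pow_le_uncorrectableProb_of_hasParams BB.bb90 Census.BB90.BB90_8_10_claim_holds (by norm_num) hy0 hy1,
    BB.pow_le_uncorrectableProb_of_hasParams BB.bb108 Census.BB108.BB108_8_10_claim_holds (by norm_num) hy0 hy1,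
    BB.pow_le_uncorrectableProb_of_hasParams BB.bb144 Census.BB144.BB144_12_12_claim_holds (by norm_num) hy0 hy1,
    BB.pow_le_uncorrectableProb_of_hasParams BB.bb288 Census.BB288.BB288_12_18_claim_holds_std (by norm_num) hy0 hy1⟩

/-- **The five codes under noisy syndrome measurement** (`T ≥ 1` rounds, ANY measurement-error rate `0 ≤ q ≤ 1`,
EVERY space-time decoder of each sector, `0 ≤ p ≤ 1/2`): the same floors `10·p³(1−p)³`, `126·p⁵(1−p)⁵`,
`126·p⁵(1−p)⁵`, `462·p⁶(1−p)⁶`, `24310·p⁹(1−p)⁹ ≤ P^{ph}_fail(p, q)`. UNCONDITIONAL.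
[cite: DennisEtAl2002, §3, §4.2–4.3, §5.2 (Prob_fail); BravyiEtAl2024, Table 1] -/
theorem bb_phenom_distanceFloors {T : ℕ} (t₀ : Fin T) {p q : ℝ} (hp0 : 0 ≤ p) (hp : p ≤ 1 / 2) (hq0 : 0 ≤ q)
    (hq1 : q ≤ 1)
    (D72 D72' : CSSPhenom.STDecoder (BB.Mono 6 6) (BB.Mono 6 6 ⊕ BB.Mono 6 6) T)
    (D90 D90' : CSSPhenom.STDecoder (BB.Mono 15 3) (BB.Mono 15 3 ⊕ BB.Mono 15 3) T)
    (D108 D108' : CSSPhenom.STDecoder (BB.Mono 9 6) (BB.Mono 9 6 ⊕ BB.Mono 9 6) T)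
    (D144 D144' : CSSPhenom.STDecoder (BB.Mono 12 6) (BB.Mono 12 6 ⊕ BB.Mono 12 6) T)
    (D288 D288' : CSSPhenom.STDecoder (BB.Mono 12 12) (BB.Mono 12 12 ⊕ BB.Mono 12 12) T) :
    (10 * (p ^ 3 * (1 - p) ^ 3) ≤ CSSPhenom.phenomFailureProb BB.bb72.css.HX T
          (BB.bb72.css.rowSpZ : Set (BB.Mono 6 6 ⊕ BB.Mono 6 6 → ZMod 2)) D72 p q ∧
        10 * (p ^ 3 * (1 - p) ^ 3) ≤ CSSPhenom.phenomFailureProb BB.bb72.css.HZ T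
          (BB.bb72.css.rowSpX : Set (BB.Mono 6 6 ⊕ BB.Mono 6 6 → ZMod 2)) D72' p q) ∧
      (126 * (p ^ 5 * (1 - p) ^ 5) ≤ CSSPhenom.phenomFailureProb BB.bb90.css.HX T
          (BB.bb90.css.rowSpZ : Set (BB.Mono 15 3 ⊕ BB.Mono 15 3 → ZMod 2)) D90 p q ∧
        126 * (p ^ 5 * (1 - p) ^ 5) ≤ CSSPhenom.phenomFailureProb BB.bb90.css.HZ T
          (BB.bb90.css.rowSpX : Set (BB.Mono 15 3 ⊕ BB.Mono 15 3 → ZMod 2)) D90' p q) ∧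
      (126 * (p ^ 5 * (1 - p) ^ 5) ≤ CSSPhenom.phenomFailureProb BB.bb108.css.HX T
          (BB.bb108.css.rowSpZ : Set (BB.Mono 9 6 ⊕ BB.Mono 9 6 → ZMod 2)) D108 p q ∧
        126 * (p ^ 5 * (1 - p) ^ 5) ≤ CSSPhenom.phenomFailureProb BB.bb108.css.HZ T
          (BB.bb108.css.rowSpX : Set (BB.Mono 9 6 ⊕ BB.Mono 9 6 → ZMod 2)) D108' p q) ∧
      (462 * (p ^ 6 * (1 - p) ^ 6) ≤ CSSPhenom.phenomFailureProb BB.bb144.css.HX T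
          (BB.bb144.css.rowSpZ : Set (BB.Mono 12 6 ⊕ BB.Mono 12 6 → ZMod 2)) D144 p q ∧
        462 * (p ^ 6 * (1 - p) ^ 6) ≤ CSSPhenom.phenomFailureProb BB.bb144.css.HZ T
          (BB.bb144.css.rowSpX : Set (BB.Mono 12 6 ⊕ BB.Mono 12 6 → ZMod 2)) D144' p q) ∧
      (24310 * (p ^ 9 * (1 - p) ^ 9) ≤ CSSPhenom.phenomFailureProb BB.bb288.css.HX T
          (BB.bb288.css.rowSpZ : Set (BB.Mono 12 12 ⊕ BB.Mono 12 12 → ZMod 2)) D288 p q ∧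
        24310 * (p ^ 9 * (1 - p) ^ 9) ≤ CSSPhenom.phenomFailureProb BB.bb288.css.HZ T
          (BB.bb288.css.rowSpX : Set (BB.Mono 12 12 ⊕ BB.Mono 12 12 → ZMod 2)) D288' p q) := by
  have h72 := BB.distanceFloor_le_phenomFailureProb_of_hasParams BB.bb72 Census.BB72.BB72_12_6_claim_holds
    (by norm_num) D72 D72' t₀ hp0 hp hq0 hq1
  have h90 := BB.distanceFloor_le_phenomFailureProb_of_hasParams BB.bb90 Census.BB90.BB90_8_10_claim_holds
    (by norm_num) D90 D90' t₀ hp0 hp hq0 hq1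
  have h108 := BB.distanceFloor_le_phenomFailureProb_of_hasParams BB.bb108 Census.BB108.BB108_8_10_claim_holds
    (by norm_num) D108 D108' t₀ hp0 hp hq0 hq1
  have h144 := BB.distanceFloor_le_phenomFailureProb_of_hasParams BB.bb144 Census.BB144.BB144_12_12_claim_holds
    (by norm_num) D144 D144' t₀ hp0 hp hq0 hq1
  have h288 := BB.distanceFloor_le_phenomFailureProb_of_hasParams BB.bb288 Census.BB288.BB288_12_18_claim_holds_std
    (by norm_num) D288 D288' t₀ hp0 hp hq0 hq1
  have hc6 : ((Nat.choose 6 ((6 + 1) / 2) : ℕ) : ℝ) = 20 := by exact_mod_cast (by decide : Nat.choose 6 ((6 + 1) / 2) = 20)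
  have hc10 : ((Nat.choose 10 ((10 + 1) / 2) : ℕ) : ℝ) = 252 := by
    exact_mod_cast (by decide : Nat.choose 10 ((10 + 1) / 2) = 252)
  have hc12 : ((Nat.choose 12 ((12 + 1) / 2) : ℕ) : ℝ) = 924 := by
    exact_mod_cast (by decide : Nat.choose 12 ((12 + 1) / 2) = 924)
  have hc18 : ((Nat.choose 18 ((18 + 1) / 2) : ℕ) : ℝ) = 48620 := by
    exact_mod_cast (by decide : Nat.choose 18 ((18 + 1) / 2) = 48620)
  rw [hc6] at h72
  rw [hc10] at h90 h108
  rw [hc12] at h144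
  rw [hc18] at h288
  simp only [Nat.reduceAdd, Nat.reduceDiv] at h72 h90 h108 h144 h288
  obtain ⟨a72, b72⟩ := h72
  obtain ⟨a90, b90⟩ := h90
  obtain ⟨a108, b108⟩ := h108
  obtain ⟨a144, b144⟩ := h144
  obtain ⟨a288, b288⟩ := h288
  exact ⟨⟨by linarith, by linarith⟩, ⟨by linarith, by linarith⟩, ⟨by linarith, by linarith⟩,
    ⟨by linarith, by linarith⟩, ⟨by linarith, by linarith⟩⟩

end Summit.Ventures.QEC.Thresholds
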